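/-
Copyright (c) 2026 the pub-hodgecm-mathlib formalisation cell (harness21).  Prover seat hodgecm-mathlib-LH4-p13 (g2), req620 Track A «(D-RAM) FOUR-FRAME» squad
(heir LEAD F0P3a-plan lineage; dealer LH4-plan lineage; MS ROAD A, Stage B brick B4 «SPLIT STRATA» of SPEC `F0/P3c/LH4/LH4-p10/g2/SPEC-StageB.v1.LH4p10g2.md` §C,
FILE 5 of the brick: the B10 SOCKETS).  2026-09-04.
-/
import Summits.HodgeConjecture.HodgeConjecture.Theorems.F0P3cDyRamDiagonalSplitCount           -- B4 FILE 2 (this seat): axis 3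
import Summits.HodgeConjecture.HodgeConjecture.Theorems.F0P3cDyRamDiagonalSplitCountAxisOne    -- B4 FILE 3 (this seat): axis 1
import Summits.HodgeConjecture.HodgeConjecture.Theorems.F0P3cDyRamDiagonalSplitCountAxisTwo    -- B4 FILE 4 (this seat): axis 2
import Summits.HodgeConjecture.HodgeConjecture.Theorems.F0P3cDyRamDiagonalHNFAxisExponents     -- ★ B2 (LH4-p08): `single_{zero,one,two}_mem_latt_hnf_pow_iff` (axis exponents of an HNF lattice)
import Summits.HodgeConjecture.HodgeConjecture.Theorems.F0P3cDyRamDiagonalStrataDefs           -- ★ DEFS LEAF p855793 (LH4-p10): `HasAxis`, `stratum`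
import Literature.NumberTheory.Automorphic.UnitaryLatticeTreeTubeCoordinate                       -- ★ `v_pow_le_v_pow_iff` (`|ϖ|^a ≤ |ϖ|^b ↔ b ≤ a`)
import Literature.NumberTheory.Automorphic.UnitaryThreeFourFrameFixedCosetDictionary            -- ★ `v_eq_one_of_mul_map_eq_one`; brings ★ `UnitaryThreeFourFrameDefs` (`IsRamifiedQuadraticDatum`, `IsElementDatum`: the binders of B10's sockets)
import HarnessLib

/-!
# Crux `H413`, MS ROAD A, STAGE B brick B4 «SPLIT STRATA», FILE 5: THE B10 SOCKETS — the on-branch strata INDEXED BY AXIS VECTOR (`(s,s,0)`, `(0,s,s)`, `(s,0,s)`, `(0,0,0)`),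
# in the binders of LH4-p10 (g2)'s assembly skeleton `B10-StableCountTypeZero.SKELETON.v1` (`stub_P_T3`, `stub_B4_T1`, `stub_P_T2`, `stub_B4_core`)

Cell `hodgecm-mathlib` (D-0151), FLOOR 0, crux item H413 = `stmt-HodgeConjecture-24833`, route of record `HCCMUnconditional`; squad F0∕P3c∕LH4 (req618∕req620).  THEOREMS ONLY
(no `def`, no instance, no notation, no `sorry`, default heartbeats); lane `--supports stmt-HodgeConjecture-24833 --as helper` (count-neutral).  Road target: tree
`Cruxes/H413/Lines/F0_P3c_DyRamFourFrame_U3_Laws.lean` stub `stub_U3_stableModelSum` (MS), via B10 `finsum_stabiliserWeight_dualisable_eq` (LH4-p10 (g2)).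

THE SOCKET SHAPE (B10 skeleton v1 `F0/P3c/LH4/LH4-p10/g2/B10-StableCountTypeZero.SKELETON.v1.LH4p10g2.lean` c61f53438acbd4dd): B10 partitions the dualisable part of `𝓛₀(T)` by the
AXIS VECTOR `a : Fin 3 → ℕ` (★ DEFS LEAF p855793 `F0P3cDyRamDiagonalStrataDefs`: `HasAxis ϖ M a :↔ ∀ i t, t·eᵢ ∈ M ↔ |t| ≤ |ϖ|^{aᵢ}`, `stratum σ ϖ T a`) and asks per `a` for `∑ᶠ M ∈ stratum σ ϖ T a, 1∕[𝒰 : S_F(M)]`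
under `(hD : IsRamifiedQuadraticDatum σ ϖ d t) (hE : IsElementDatum σ ϖ N₀ α β n₁ n₂ n₃) (hT : T = diag(α, β, 1)) (s) (hs : 1 ≤ s)`, `[Fintype 𝓀[K]]`, answer `if 2 ∣ s ∧ s ≤ nᵢ then
(Fintype.card 𝓀[K] : ℚ)^(s∕2) else 0`.  §1 BRIDGES (`M ∈ 𝓛₀(T)`, `s ≥ 1`): `HasAxis (s,s,0) ↔ M = M₃(s,x)`, `(0,s,s) ↔ M = M₁(s,z)`, `(s,0,s) ↔ M = M₂(s,y)` with a unit parameter (HNF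
existence ★ `exists_latt_eq_latt_hnf`, axis exponents ★ B2, comparison ★ `latt_hnf_eq_latt_hnf_iff`).  §2 SOCKETS `finsum_stabiliserWeight_hasAxis_T3 ∕ _T1 ∕ _T2` (FILES 2–4's
orbit ∕ empty ∕ empty trichotomy makes the `if` exhaustive) and `finsum_stabiliserWeight_hasAxis_core = 1` (axis `(0,0,0)` singles out the root `𝒪³`; `S_F(𝒪³) = 𝒰`, weight `1`).
HONEST LABEL.  Count-neutral (`--supports`); nothing printed is asserted; (MS) and the census laws stay PROVER TARGETS until B3∕B5–B7∕B9∕B10 land; `HC_CM` is proved only modulo the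
7 printed citations (2 remaining named inputs: hLiu418 = `stmt-HodgeConjecture-24832`, h413 = `stmt-HodgeConjecture-24833`) until rung 0 closes.

## References
* [Kottwitz1986BaseChangeUnits] R. E. Kottwitz, *Base change for unit elements of Hecke algebras*, Compositio Math. 60 (1986), §1 pp. 240–241.
* [Rogawski1990] J. D. Rogawski, *Automorphic Representations of Unitary Groups in Three Variables*, Ann. of Math. Stud. 123 (1990), §4.9 Prop. 4.9.1 (a) p. 55.
* [Serre1980Trees] J.-P. Serre, *Trees*, Springer (1980), Ch. II §1.1 (lattices, Hermite normal form, the diagonal action).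
-/

set_option autoImplicit false

noncomputable section

namespace Summit.HodgeConjecture.HodgeConjecture.Cruxes.H413.F0P3cDyRamDiagonalSplitCountSockets

open Matrix
open Literature.NumberTheory.Automorphic Literature.NumberTheory.Automorphic.HermitianLattice
open Literature.NumberTheory.Automorphic.UnitaryLatticeTree Literature.NumberTheory.Automorphic.UnitaryThreeFourFrame
open Summit.HodgeConjecture.HodgeConjecture.Cruxes.H413.F0P3cDyRamDiagonalTorusDefs
open Summit.HodgeConjecture.HodgeConjecture.Cruxes.H413.F0P3cDyRamDiagonalStrataDefs
open Summit.HodgeConjecture.HodgeConjecture.Cruxes.H413.F0P3cDyRamDiagonalStratumTools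
open Summit.HodgeConjecture.HodgeConjecture.Cruxes.H413.F0P3cDyRamDiagonalSplitCount
open Summit.HodgeConjecture.HodgeConjecture.Cruxes.H413.F0P3cDyRamDiagonalSplitCountAxisOne
open Summit.HodgeConjecture.HodgeConjecture.Cruxes.H413.F0P3cDyRamDiagonalSplitCountAxisTwo
open Summit.HodgeConjecture.HodgeConjecture.Cruxes.H413.F0P3cDyRamDiagonalHNFAxisExponents
open Summit.HodgeConjecture.HodgeConjecture.Cruxes.H413.F0P3cDyRamDiagonalStableLatticeHNF (normalised_latt_hnf_iff)
open Summit.HodgeConjecture.HodgeConjecture.Cruxes.H413.F0P3cDyRamDiagonalStableLatticeHNFExists (exists_latt_eq_latt_hnf latt_hnf_eq_latt_hnf_iff)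
open Summit.HodgeConjecture.HodgeConjecture.Cruxes.H413.F0P3cDyRamDiagonalCoreUnique
open scoped Valued WithZero Matrix MatrixGroups

section Bridges

variable {K : Type*} [Field K] [Valued K ℤᵐ⁰]

/-! ## §0  Small valuation facts -/

/-- `|ϖ|^c ≥ 1` forces `c = 0` for a uniformiser. [cite: Serre1980Trees, II §1.1] -/
theorem eq_zero_of_one_le_v_pow {ϖ : K} (hϖ : Valued.v ϖ = WithZero.exp (-1 : ℤ)) {c : ℕ} (h : (1 : ℤᵐ⁰) ≤ Valued.v ϖ ^ c) : c = 0 := by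
  rw [Literature.NumberTheory.LocalFields.WildQuadraticDatum.v_varpi_pow hϖ, ← WithZero.exp_zero, WithZero.exp_le_exp] at h; omega

/-- The HNF of a member of `𝓛₀(T)`: `M = latt (1 0 0; x ϖ^b 0; y z ϖ^c)` with integral parameters. [cite: Serre1980Trees, II §1.1] -/
theorem exists_hnf_of_mem_normalisedStableLattices {ϖ : K} (hϖ : Valued.v ϖ = WithZero.exp (-1 : ℤ)) {T : GL (Fin 3) K} {M : Submodule 𝒪[K] (Fin 3 → K)}
    (hM : M ∈ normalisedStableLattices T) :
    ∃ (b c : ℕ) (x y z : K), Valued.v x ≤ 1 ∧ Valued.v y ≤ 1 ∧ Valued.v z ≤ 1 ∧ M = latt (Matrix.of ![![1, 0, 0], ![x, ϖ ^ b, 0], ![y, z, ϖ ^ c]]) := by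
  obtain ⟨⟨g, rfl⟩, -, hN⟩ := hM
  exact exists_latt_eq_latt_hnf hϖ g (fun w hw => mem_stdLattice.2 fun i => (hN i).1 w hw) (hN 0).2

/-! ## §1  Axis vectors ↔ normal forms -/

/-- **AXIS `(s,s,0)` ⟺ `M = M₃(s,x)`** (`M ∈ 𝓛₀(T)`, `s ≥ 1`, `x` a unit). [cite: Serre1980Trees, II §1.1] [cite: Kottwitz1986BaseChangeUnits, §1 pp. 240–241] -/
theorem hasAxis_axis3_iff {ϖ : K} (hϖ : Valued.v ϖ = WithZero.exp (-1 : ℤ)) {T : GL (Fin 3) K} {M : Submodule 𝒪[K] (Fin 3 → K)}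
    (hM : M ∈ normalisedStableLattices T) {s : ℕ} (hs : 1 ≤ s) :
    HasAxis ϖ M ![s, s, 0] ↔
      ∃ x : K, Valued.v x = 1 ∧ M = latt (!![1, 0, 0; x, ϖ ^ s, 0; 0, 0, 1] : Matrix (Fin 3) (Fin 3) K) := by
  have hϖ0 : ϖ ≠ 0 := fun h0 => by rw [h0, map_zero] at hϖ; exact WithZero.coe_ne_zero hϖ.symm
  have hϖ1 : Valued.v ϖ ≤ 1 := by rw [hϖ, ← WithZero.exp_zero, WithZero.exp_le_exp]; norm_num
  constructor
  · intro hax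
    obtain ⟨b, c, x, y, z, hx, hy, hz, hMeq⟩ := exists_hnf_of_mem_normalisedStableLattices hϖ hM
    -- `c = 0` from the axis `e₂`
    have hc : c = 0 := by
      have h2 : (Pi.single 2 (1 : K) : Fin 3 → K) ∈ M := (hax 2 1).2 (by simp)
      rw [hMeq, single_two_mem_latt_hnf_pow_iff hϖ0 b c x y z, map_one] at h2
      exact eq_zero_of_one_le_v_pow hϖ h2
    subst hc
    -- `b = s` from the axis `e₁`
    have hb : b = s := by
      have h1 : (Pi.single 1 (ϖ ^ b) : Fin 3 → K) ∈ M := by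
        rw [hMeq, single_one_mem_latt_hnf_pow_iff hϖ0 b 0 x y z, map_pow, add_zero, map_mul, map_pow]
        exact ⟨le_rfl, mul_le_of_le_one_right' hz⟩
      have h1' := ((hax 1 (ϖ ^ b)).1 h1)
      have h2 : (Pi.single 1 (ϖ ^ s) : Fin 3 → K) ∈ M := (hax 1 (ϖ ^ s)).2 (by rw [map_pow]; exact le_rfl)
      rw [hMeq, single_one_mem_latt_hnf_pow_iff hϖ0 b 0 x y z, map_pow] at h2
      rw [map_pow] at h1'
      exact le_antisymm ((UnitaryLatticeTree.v_pow_le_v_pow_iff hϖ s b).1 h2.1) ((UnitaryLatticeTree.v_pow_le_v_pow_iff hϖ b s).1 h1')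
    subst hb
    have hMeq' : M = latt (!![1, 0, 0; x, ϖ ^ b, 0; y, z, 1] : Matrix (Fin 3) (Fin 3) K) := by rw [hMeq, pow_zero]
    exact (axis3_hnf_iff hϖ hs hM.2.2).1 ⟨x, y, z, hMeq'⟩
  · rintro ⟨x, hx, rfl⟩
    have e : (!![1, 0, 0; x, ϖ ^ s, 0; 0, 0, 1] : Matrix (Fin 3) (Fin 3) K) = Matrix.of ![![1, 0, 0], ![x, ϖ ^ s, 0], ![0, 0, ϖ ^ 0]] := by
      rw [pow_zero]
    rw [e]
    have h0 : ∀ t : K, (Pi.single 0 t : Fin 3 → K) ∈ latt (Matrix.of ![![1, 0, 0], ![x, ϖ ^ s, 0], ![0, 0, ϖ ^ 0]]) ↔ Valued.v t ≤ Valued.v ϖ ^ s := by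
      intro t
      rw [single_zero_mem_latt_hnf_pow_iff hϖ0 s 0 x 0 0 t, map_mul, hx, mul_one]
      refine ⟨fun h => h.2.1, fun h => ⟨h.trans (pow_le_one' hϖ1 _), h, by simp⟩⟩
    have h1 : ∀ t : K, (Pi.single 1 t : Fin 3 → K) ∈ latt (Matrix.of ![![1, 0, 0], ![x, ϖ ^ s, 0], ![0, 0, ϖ ^ 0]]) ↔ Valued.v t ≤ Valued.v ϖ ^ s := by
      intro t
      rw [single_one_mem_latt_hnf_pow_iff hϖ0 s 0 x 0 0 t]
      exact ⟨fun h => h.1, fun h => ⟨h, by simp⟩⟩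
    have h2 : ∀ t : K, (Pi.single 2 t : Fin 3 → K) ∈ latt (Matrix.of ![![1, 0, 0], ![x, ϖ ^ s, 0], ![0, 0, ϖ ^ 0]]) ↔ Valued.v t ≤ Valued.v ϖ ^ 0 :=
      fun t => single_two_mem_latt_hnf_pow_iff hϖ0 s 0 x 0 0 t
    intro i t
    fin_cases i
    exacts [h0 t, h1 t, h2 t]

/-- **AXIS `(0,s,s)` ⟺ `M = M₁(s,z)`** (`M ∈ 𝓛₀(T)`, `s ≥ 1`, `z` a unit). [cite: Serre1980Trees, II §1.1] [cite: Kottwitz1986BaseChangeUnits, §1 pp. 240–241] -/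
theorem hasAxis_axis1_iff {ϖ : K} (hϖ : Valued.v ϖ = WithZero.exp (-1 : ℤ)) {T : GL (Fin 3) K} {M : Submodule 𝒪[K] (Fin 3 → K)}
    (hM : M ∈ normalisedStableLattices T) {s : ℕ} (hs : 1 ≤ s) :
    HasAxis ϖ M ![0, s, s] ↔
      ∃ z : K, Valued.v z = 1 ∧ M = latt (!![1, 0, 0; 0, 1, 0; 0, z, ϖ ^ s] : Matrix (Fin 3) (Fin 3) K) := by
  have hϖ0 : ϖ ≠ 0 := fun h0 => by rw [h0, map_zero] at hϖ; exact WithZero.coe_ne_zero hϖ.symm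
  have hϖ1 : Valued.v ϖ ≤ 1 := by rw [hϖ, ← WithZero.exp_zero, WithZero.exp_le_exp]; norm_num
  constructor
  · intro hax
    obtain ⟨b, c, x, y, z, hx, hy, hz, hMeq⟩ := exists_hnf_of_mem_normalisedStableLattices hϖ hM
    -- `c = s` from the axis `e₂`
    have hc : c = s := by
      have h2 : (Pi.single 2 (ϖ ^ c) : Fin 3 → K) ∈ M := by
        rw [hMeq, single_two_mem_latt_hnf_pow_iff hϖ0 b c x y z, map_pow]
      have h2' := (hax 2 (ϖ ^ c)).1 h2
      have h3 : (Pi.single 2 (ϖ ^ s) : Fin 3 → K) ∈ M := (hax 2 (ϖ ^ s)).2 (by rw [map_pow]; exact le_rfl)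
      rw [hMeq, single_two_mem_latt_hnf_pow_iff hϖ0 b c x y z, map_pow] at h3
      rw [map_pow] at h2'
      exact le_antisymm ((UnitaryLatticeTree.v_pow_le_v_pow_iff hϖ s c).1 h3) ((UnitaryLatticeTree.v_pow_le_v_pow_iff hϖ c s).1 h2')
    subst hc
    -- `b = 0` and `|y − x z| ≤ |ϖ|^s` from `e₀ ∈ M`
    have h0 : (Pi.single 0 (1 : K) : Fin 3 → K) ∈ M := (hax 0 1).2 (by simp)
    rw [hMeq, single_zero_mem_latt_hnf_pow_iff hϖ0 b c x y z, one_mul, one_mul] at h0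
    have hb : b = 0 := by
      rcases ((normalised_latt_hnf_iff hx hy hz (by rw [map_pow]; exact pow_le_one' hϖ1 _) (by rw [map_pow]; exact pow_le_one' hϖ1 _)).1
        (hMeq ▸ hM.2.2)).1 with hp | hx1
      · rw [map_pow] at hp; exact eq_zero_of_one_le_v_pow hϖ hp.ge
      · exact eq_zero_of_one_le_v_pow hϖ (hx1 ▸ h0.2.1)
    subst hb
    -- `z` is a unit from the axis `e₁`
    have hzu : Valued.v z = 1 := by
      by_contra hne
      have hzlt : Valued.v z < 1 := lt_of_le_of_ne hz hne
      have hzle : Valued.v z ≤ Valued.v ϖ := by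
        rw [hϖ]
        rcases eq_or_ne z 0 with rfl | hz0
        · rw [map_zero]; exact zero_le
        · obtain ⟨n, hn⟩ : ∃ n : ℤ, Valued.v z = WithZero.exp n := ⟨_, (WithZero.coe_unzero ((Valuation.ne_zero_iff _).2 hz0)).symm⟩
          rw [hn, WithZero.exp_le_exp]
          rw [hn, ← WithZero.exp_zero, WithZero.exp_lt_exp] at hzlt
          omega
      obtain ⟨m, rfl⟩ : ∃ m, c = m + 1 := ⟨c - 1, by omega⟩
      have h1 : (Pi.single 1 (ϖ ^ m) : Fin 3 → K) ∈ M := by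
        rw [hMeq, single_one_mem_latt_hnf_pow_iff hϖ0 0 (m + 1) x y z, pow_zero, map_pow, zero_add, map_mul, map_pow, pow_succ]
        exact ⟨pow_le_one' hϖ1 _, by gcongr⟩
      have h1' := (hax 1 (ϖ ^ m)).1 h1
      rw [map_pow] at h1'
      have := (UnitaryLatticeTree.v_pow_le_v_pow_iff hϖ m (m + 1)).1 h1'
      omega
    refine ⟨z, hzu, ?_⟩
    rw [hMeq, show (!![1, 0, 0; 0, 1, 0; 0, z, ϖ ^ c] : Matrix (Fin 3) (Fin 3) K) = Matrix.of ![![1, 0, 0], ![0, ϖ ^ 0, 0], ![0, z, ϖ ^ c]] by rw [pow_zero],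
      latt_hnf_eq_latt_hnf_iff x y z 0 0 z (pow_ne_zero _ hϖ0) (pow_ne_zero _ hϖ0)]
    refine ⟨by rw [sub_zero, pow_zero, map_one]; exact hx, by rw [sub_self, map_zero]; exact zero_le, ?_⟩
    rw [sub_zero, sub_zero, ← pow_add, map_pow]
    have e : y * ϖ ^ 0 - z * x = y * ϖ ^ 0 - x * z := by ring
    rw [e]; exact h0.2.2
  · rintro ⟨z, hz, rfl⟩
    have e : (!![1, 0, 0; 0, 1, 0; 0, z, ϖ ^ s] : Matrix (Fin 3) (Fin 3) K) = Matrix.of ![![1, 0, 0], ![0, ϖ ^ 0, 0], ![0, z, ϖ ^ s]] := by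
      rw [pow_zero]
    rw [e]
    have h0 : ∀ t : K, (Pi.single 0 t : Fin 3 → K) ∈ latt (Matrix.of ![![1, 0, 0], ![0, ϖ ^ 0, 0], ![0, z, ϖ ^ s]]) ↔ Valued.v t ≤ Valued.v ϖ ^ 0 := by
      intro t
      rw [single_zero_mem_latt_hnf_pow_iff hϖ0 0 s 0 0 z t]
      refine ⟨fun h => (pow_zero (Valued.v ϖ)).symm ▸ h.1, fun h => ⟨(pow_zero (Valued.v ϖ)) ▸ h, by simp, by simp⟩⟩
    have h1 : ∀ t : K, (Pi.single 1 t : Fin 3 → K) ∈ latt (Matrix.of ![![1, 0, 0], ![0, ϖ ^ 0, 0], ![0, z, ϖ ^ s]]) ↔ Valued.v t ≤ Valued.v ϖ ^ s := by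
      intro t
      rw [single_one_mem_latt_hnf_pow_iff hϖ0 0 s 0 0 z t, pow_zero, zero_add, map_mul, hz, mul_one]
      exact ⟨fun h => h.2, fun h => ⟨h.trans (pow_le_one' hϖ1 _), h⟩⟩
    have h2 : ∀ t : K, (Pi.single 2 t : Fin 3 → K) ∈ latt (Matrix.of ![![1, 0, 0], ![0, ϖ ^ 0, 0], ![0, z, ϖ ^ s]]) ↔ Valued.v t ≤ Valued.v ϖ ^ s :=
      fun t => single_two_mem_latt_hnf_pow_iff hϖ0 0 s 0 0 z t
    intro i t
    fin_cases i
    exacts [h0 t, h1 t, h2 t]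

/-- **AXIS `(s,0,s)` ⟺ `M = M₂(s,y)`** (`M ∈ 𝓛₀(T)`, `s ≥ 1`, `y` a unit). [cite: Serre1980Trees, II §1.1] [cite: Kottwitz1986BaseChangeUnits, §1 pp. 240–241] -/
theorem hasAxis_axis2_iff {ϖ : K} (hϖ : Valued.v ϖ = WithZero.exp (-1 : ℤ)) {T : GL (Fin 3) K} {M : Submodule 𝒪[K] (Fin 3 → K)}
    (hM : M ∈ normalisedStableLattices T) {s : ℕ} (hs : 1 ≤ s) :
    HasAxis ϖ M ![s, 0, s] ↔
      ∃ y : K, Valued.v y = 1 ∧ M = latt (!![1, 0, 0; 0, 1, 0; y, 0, ϖ ^ s] : Matrix (Fin 3) (Fin 3) K) := by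
  have hϖ0 : ϖ ≠ 0 := fun h0 => by rw [h0, map_zero] at hϖ; exact WithZero.coe_ne_zero hϖ.symm
  have hϖ1 : Valued.v ϖ ≤ 1 := by rw [hϖ, ← WithZero.exp_zero, WithZero.exp_le_exp]; norm_num
  have hvs : Valued.v ϖ ^ s < 1 := by
    rw [Literature.NumberTheory.LocalFields.WildQuadraticDatum.v_varpi_pow hϖ, ← WithZero.exp_zero, WithZero.exp_lt_exp]; omega
  constructor
  · intro hax
    obtain ⟨b, c, x, y, z, hx, hy, hz, hMeq⟩ := exists_hnf_of_mem_normalisedStableLattices hϖ hM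
    -- `c = s` from the axis `e₂`
    have hc : c = s := by
      have h2 : (Pi.single 2 (ϖ ^ c) : Fin 3 → K) ∈ M := by
        rw [hMeq, single_two_mem_latt_hnf_pow_iff hϖ0 b c x y z, map_pow]
      have h2' := (hax 2 (ϖ ^ c)).1 h2
      have h3 : (Pi.single 2 (ϖ ^ s) : Fin 3 → K) ∈ M := (hax 2 (ϖ ^ s)).2 (by rw [map_pow]; exact le_rfl)
      rw [hMeq, single_two_mem_latt_hnf_pow_iff hϖ0 b c x y z, map_pow] at h3
      rw [map_pow] at h2'
      exact le_antisymm ((UnitaryLatticeTree.v_pow_le_v_pow_iff hϖ s c).1 h3) ((UnitaryLatticeTree.v_pow_le_v_pow_iff hϖ c s).1 h2')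
    subst hc
    -- `b = 0` and `|z| ≤ |ϖ|^s` from `e₁ ∈ M`
    have h1 : (Pi.single 1 (1 : K) : Fin 3 → K) ∈ M := (hax 1 1).2 (by simp)
    rw [hMeq, single_one_mem_latt_hnf_pow_iff hϖ0 b c x y z, map_one, one_mul] at h1
    have hb : b = 0 := eq_zero_of_one_le_v_pow hϖ h1.1
    subst hb
    rw [zero_add] at h1
    -- `y` is a unit from normalisation at slot 2
    have hyu : Valued.v y = 1 := by
      rcases ((normalised_latt_hnf_iff hx hy hz (by rw [map_pow]; exact pow_le_one' hϖ1 _) (by rw [map_pow]; exact pow_le_one' hϖ1 _)).1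
        (hMeq ▸ hM.2.2)).2 with hr | hy1 | hz1
      · rw [map_pow] at hr; exact absurd hr hvs.ne
      · exact hy1
      · exact absurd (hz1 ▸ h1.2) (not_le.2 hvs)
    refine ⟨y, hyu, ?_⟩
    rw [hMeq, show (!![1, 0, 0; 0, 1, 0; y, 0, ϖ ^ c] : Matrix (Fin 3) (Fin 3) K) = Matrix.of ![![1, 0, 0], ![0, ϖ ^ 0, 0], ![y, 0, ϖ ^ c]] by rw [pow_zero],
      latt_hnf_eq_latt_hnf_iff x y z 0 y 0 (pow_ne_zero _ hϖ0) (pow_ne_zero _ hϖ0)]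
    refine ⟨by rw [sub_zero, pow_zero, map_one]; exact hx, by rw [sub_zero, map_pow]; exact h1.2, ?_⟩
    rw [sub_self, zero_mul, zero_mul, sub_zero, map_zero]
    exact zero_le
  · rintro ⟨y, hy, rfl⟩
    have e : (!![1, 0, 0; 0, 1, 0; y, 0, ϖ ^ s] : Matrix (Fin 3) (Fin 3) K) = Matrix.of ![![1, 0, 0], ![0, ϖ ^ 0, 0], ![y, 0, ϖ ^ s]] := by
      rw [pow_zero]
    rw [e]
    have h0 : ∀ t : K, (Pi.single 0 t : Fin 3 → K) ∈ latt (Matrix.of ![![1, 0, 0], ![0, ϖ ^ 0, 0], ![y, 0, ϖ ^ s]]) ↔ Valued.v t ≤ Valued.v ϖ ^ s := by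
      intro t
      rw [single_zero_mem_latt_hnf_pow_iff hϖ0 0 s 0 y 0 t]
      have ey : t * (y * ϖ ^ 0 - 0 * 0) = t * y := by ring
      rw [ey, zero_add, mul_zero, map_zero, map_mul, hy, mul_one]
      refine ⟨fun h => h.2.2, fun h => ⟨h.trans (pow_le_one' hϖ1 _), zero_le, h⟩⟩
    have h1 : ∀ t : K, (Pi.single 1 t : Fin 3 → K) ∈ latt (Matrix.of ![![1, 0, 0], ![0, ϖ ^ 0, 0], ![y, 0, ϖ ^ s]]) ↔ Valued.v t ≤ Valued.v ϖ ^ 0 := by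
      intro t
      rw [single_one_mem_latt_hnf_pow_iff hϖ0 0 s 0 y 0 t]
      exact ⟨fun h => h.1, fun h => ⟨h, by simp⟩⟩
    have h2 : ∀ t : K, (Pi.single 2 t : Fin 3 → K) ∈ latt (Matrix.of ![![1, 0, 0], ![0, ϖ ^ 0, 0], ![y, 0, ϖ ^ s]]) ↔ Valued.v t ≤ Valued.v ϖ ^ s :=
      fun t => single_two_mem_latt_hnf_pow_iff hϖ0 0 s 0 y 0 t
    intro i t
    fin_cases i
    exacts [h0 t, h1 t, h2 t]

/-- Unit diagonals fix the root: `diag(u)·𝒪³ = 𝒪³` for `|u_i| = 1`. [cite: Serre1980Trees, II §1.1] -/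
theorem mapGL_diagonal_stdLattice_eq {u : Fin 3 → K} (hu : ∀ i, Valued.v (u i) = 1) (U : GL (Fin 3) K)
    (hU : (U : Matrix (Fin 3) (Fin 3) K) = Matrix.diagonal u) : mapGL U (stdLattice K 3) = stdLattice K 3 := by
  rw [← latt_one, mapGL, ← latt_mul, hU, Matrix.mul_one, ← Matrix.one_mul (Matrix.diagonal u)]
  exact latt_mul_eq_latt_of_isIntMatrix (by rw [Matrix.det_one]; exact isUnit_one)
    (by rw [isUnit_iff_ne_zero, (Valuation.ne_zero_iff Valued.v).symm, v_det_diagonal_eq_one hu]; exact one_ne_zero)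
    (isIntMatrix_diagonal_of_v_le fun i => (hu i).le) (isIntMatrix_diagonal_inv_of_v_eq_one hu)

end Bridges

/-! ## §2  The B10 sockets: axis-vector strata under the skeleton's binders (`K : Type`, `[Fintype 𝓀[K]]`, as in ★ `UnitaryThreeFourFrameDefs`) -/

section Sockets

variable {K : Type} [Field K] [Valued K ℤᵐ⁰] [Fintype 𝓀[K]] {σ : K →+* K} {ϖ : K} {d t : ℕ} {α β : K} {N₀ n₁ n₂ n₃ : ℕ} {T : GL (Fin 3) K}

/-- **SOCKET `stub_P_T3` — AXIS `(s,s,0)`**: `∑ᶠ_{M ∈ 𝓛₀(T), dualisable, HasAxis (s,s,0)} 1∕[𝒰 : S_F(M)] = q^{s∕2}` if `2 ∣ s ∧ s ≤ n₃`, else `0` (`s ≥ 1`; `n₃ = v(α − β)`).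
[cite: Rogawski1990, §4.9 Prop. 4.9.1 (a) p. 55] [cite: Kottwitz1986BaseChangeUnits, §1 pp. 240–241] -/
theorem finsum_stabiliserWeight_hasAxis_T3 (hD : IsRamifiedQuadraticDatum σ ϖ d t) (hE : IsElementDatum σ ϖ N₀ α β n₁ n₂ n₃)
    (hT : (T : Matrix (Fin 3) (Fin 3) K) = Matrix.diagonal ![α, β, 1]) (s : ℕ) (hs : 1 ≤ s) :
    ∑ᶠ M ∈ stratum σ ϖ T ![s, s, 0], stabiliserWeight σ M = if 2 ∣ s ∧ s ≤ n₃ then ((Fintype.card 𝓀[K] : ℚ) ^ (s / 2)) else 0 := by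
  obtain ⟨hσ, hvσ, hϖ, hfix, hd, -, -⟩ := hD
  obtain ⟨hαn, hβn, -, -, -, -, -, h₃, -, -, -⟩ := hE
  have hα := v_eq_one_of_mul_map_eq_one hvσ hαn
  have hβ := v_eq_one_of_mul_map_eq_one hvσ hβn
  have hset : stratum σ ϖ T ![s, s, 0] = {M | M ∈ normalisedStableLattices T ∧ IsDualisableLattice σ ϖ M ∧
      ∃ x : K, Valued.v x = 1 ∧ M = latt (!![1, 0, 0; x, ϖ ^ s, 0; 0, 0, 1] : Matrix (Fin 3) (Fin 3) K)} :=
    Set.ext fun M => ⟨fun ⟨h1, h2, h3⟩ => ⟨h1, h2, (hasAxis_axis3_iff hϖ h1 hs).1 h3⟩, fun ⟨h1, h2, h3⟩ => ⟨h1, h2, (hasAxis_axis3_iff hϖ h1 hs).2 h3⟩⟩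
  rw [hset]
  split_ifs with hc
  · rw [← Nat.card_eq_fintype_card]
    exact finsum_stabiliserWeight_axis3Stratum hσ hvσ hfix hϖ hd T hT hα hβ (map_one _) h₃ hc.1 (by obtain ⟨⟨j, hj⟩, -⟩ := hc; omega) hc.2
  · rcases not_and_or.1 hc with hodd | hlt
    · rw [axis3Stratum_eq_empty_of_not_two_dvd hvσ hfix hϖ T hodd, finsum_mem_empty]
    · rw [axis3Stratum_eq_empty σ hϖ T hT hα hβ (map_one _) h₃ (not_le.1 hlt), finsum_mem_empty]

/-- **SOCKET `stub_B4_T1` — AXIS `(0,s,s)`**: `q^{s∕2}` if `2 ∣ s ∧ s ≤ n₁`, else `0` (`s ≥ 1`; `n₁ = v(β − 1)`). [cite: Rogawski1990, §4.9 Prop. 4.9.1 (a) p. 55] -/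
theorem finsum_stabiliserWeight_hasAxis_T1 (hD : IsRamifiedQuadraticDatum σ ϖ d t) (hE : IsElementDatum σ ϖ N₀ α β n₁ n₂ n₃)
    (hT : (T : Matrix (Fin 3) (Fin 3) K) = Matrix.diagonal ![α, β, 1]) (s : ℕ) (hs : 1 ≤ s) :
    ∑ᶠ M ∈ stratum σ ϖ T ![0, s, s], stabiliserWeight σ M = if 2 ∣ s ∧ s ≤ n₁ then ((Fintype.card 𝓀[K] : ℚ) ^ (s / 2)) else 0 := by
  obtain ⟨hσ, hvσ, hϖ, hfix, hd, -, -⟩ := hD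
  obtain ⟨hαn, hβn, -, -, -, h₁, -, -, -, -, -⟩ := hE
  have hα := v_eq_one_of_mul_map_eq_one hvσ hαn
  have hβ := v_eq_one_of_mul_map_eq_one hvσ hβn
  have hset : stratum σ ϖ T ![0, s, s] = {M | M ∈ normalisedStableLattices T ∧ IsDualisableLattice σ ϖ M ∧
      ∃ z : K, Valued.v z = 1 ∧ M = latt (!![1, 0, 0; 0, 1, 0; 0, z, ϖ ^ s] : Matrix (Fin 3) (Fin 3) K)} :=
    Set.ext fun M => ⟨fun ⟨h1, h2, h3⟩ => ⟨h1, h2, (hasAxis_axis1_iff hϖ h1 hs).1 h3⟩, fun ⟨h1, h2, h3⟩ => ⟨h1, h2, (hasAxis_axis1_iff hϖ h1 hs).2 h3⟩⟩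
  rw [hset]
  split_ifs with hc
  · rw [← Nat.card_eq_fintype_card]
    exact finsum_stabiliserWeight_axis1Stratum hσ hvσ hfix hϖ hd T hT hα hβ (map_one _) h₁ hc.1 (by obtain ⟨⟨j, hj⟩, -⟩ := hc; omega) hc.2
  · rcases not_and_or.1 hc with hodd | hlt
    · rw [axis1Stratum_eq_empty_of_not_two_dvd hvσ hfix hϖ T hodd, finsum_mem_empty]
    · rw [axis1Stratum_eq_empty σ hϖ T hT hα hβ (map_one _) h₁ (not_le.1 hlt), finsum_mem_empty]

/-- **SOCKET `stub_P_T2` — AXIS `(s,0,s)`**: `q^{s∕2}` if `2 ∣ s ∧ s ≤ n₂`, else `0` (`s ≥ 1`; `n₂ = v(α − 1)`). [cite: Rogawski1990, §4.9 Prop. 4.9.1 (a) p. 55] -/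
theorem finsum_stabiliserWeight_hasAxis_T2 (hD : IsRamifiedQuadraticDatum σ ϖ d t) (hE : IsElementDatum σ ϖ N₀ α β n₁ n₂ n₃)
    (hT : (T : Matrix (Fin 3) (Fin 3) K) = Matrix.diagonal ![α, β, 1]) (s : ℕ) (hs : 1 ≤ s) :
    ∑ᶠ M ∈ stratum σ ϖ T ![s, 0, s], stabiliserWeight σ M = if 2 ∣ s ∧ s ≤ n₂ then ((Fintype.card 𝓀[K] : ℚ) ^ (s / 2)) else 0 := by
  obtain ⟨hσ, hvσ, hϖ, hfix, hd, -, -⟩ := hD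
  obtain ⟨hαn, hβn, -, -, -, -, h₂, -, -, -, -⟩ := hE
  have hα := v_eq_one_of_mul_map_eq_one hvσ hαn
  have hβ := v_eq_one_of_mul_map_eq_one hvσ hβn
  have hset : stratum σ ϖ T ![s, 0, s] = {M | M ∈ normalisedStableLattices T ∧ IsDualisableLattice σ ϖ M ∧
      ∃ y : K, Valued.v y = 1 ∧ M = latt (!![1, 0, 0; 0, 1, 0; y, 0, ϖ ^ s] : Matrix (Fin 3) (Fin 3) K)} :=
    Set.ext fun M => ⟨fun ⟨h1, h2, h3⟩ => ⟨h1, h2, (hasAxis_axis2_iff hϖ h1 hs).1 h3⟩, fun ⟨h1, h2, h3⟩ => ⟨h1, h2, (hasAxis_axis2_iff hϖ h1 hs).2 h3⟩⟩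
  rw [hset]
  split_ifs with hc
  · rw [← Nat.card_eq_fintype_card]
    exact finsum_stabiliserWeight_axis2Stratum hσ hvσ hfix hϖ hd T hT hα hβ (map_one _) h₂ hc.1 (by obtain ⟨⟨j, hj⟩, -⟩ := hc; omega) hc.2
  · rcases not_and_or.1 hc with hodd | hlt
    · rw [axis2Stratum_eq_empty_of_not_two_dvd hvσ hfix hϖ T hodd, finsum_mem_empty]
    · rw [axis2Stratum_eq_empty σ hϖ T hT hα hβ (map_one _) h₂ (not_le.1 hlt), finsum_mem_empty]

omit [Fintype 𝓀[K]] in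
/-- **SOCKET `stub_B4_core` — AXIS `(0,0,0)`**: the only member of `𝓛₀(T)` with axis `(0,0,0)` is the root `𝒪³` (all `eᵢ ∈ M ≤ 𝒪³`); it is dualisable (`diag(1,1,1)`) with
`S_F(𝒪³) = 𝒰`, weight `1`: contribution `1`. [cite: Rogawski1990, §4.9 Prop. 4.9.1 (a) p. 55] [cite: Kottwitz1986BaseChangeUnits, §1 pp. 240–241] -/
theorem finsum_stabiliserWeight_hasAxis_core (hD : IsRamifiedQuadraticDatum σ ϖ d t) (hE : IsElementDatum σ ϖ N₀ α β n₁ n₂ n₃)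
    (hT : (T : Matrix (Fin 3) (Fin 3) K) = Matrix.diagonal ![α, β, 1]) :
    ∑ᶠ M ∈ stratum σ ϖ T ![0, 0, 0], stabiliserWeight σ M = 1 := by
  obtain ⟨-, hvσ, hϖ, -, -, -, -⟩ := hD
  obtain ⟨hαn, hβn, -, -, -, -, -, -, -, -, -⟩ := hE
  have hα := v_eq_one_of_mul_map_eq_one hvσ hαn
  have hβ := v_eq_one_of_mul_map_eq_one hvσ hβn
  have hϖ1 : Valued.v ϖ ≤ 1 := by rw [hϖ, ← WithZero.exp_zero, WithZero.exp_le_exp]; norm_num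
  have hu : ∀ i, Valued.v ((![α, β, 1] : Fin 3 → K) i) = 1 := by intro i; fin_cases i <;> simp [hα, hβ]
  -- the axis condition of the root: `t eᵢ ∈ 𝒪³ ↔ |t| ≤ 1`
  have hroot : ∀ (i : Fin 3) (t : K), (Pi.single i t : Fin 3 → K) ∈ stdLattice K 3 ↔ Valued.v t ≤ Valued.v ϖ ^ ((![0, 0, 0] : Fin 3 → ℕ) i) := by
    intro i t
    have e0 : ((![0, 0, 0] : Fin 3 → ℕ) i) = 0 := by fin_cases i <;> rfl
    rw [e0, pow_zero, mem_stdLattice]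
    refine ⟨fun h => by simpa using h i, fun h j => ?_⟩
    rcases eq_or_ne j i with rfl | hj
    · rwa [Pi.single_eq_same]
    · rw [Pi.single_eq_of_ne hj, map_zero]; exact zero_le
  have hset : stratum σ ϖ T ![0, 0, 0] = {stdLattice K 3} := by
    ext M
    rw [mem_stratum_iff, Set.mem_singleton_iff]
    constructor
    · rintro ⟨⟨-, -, hN⟩, -, hax⟩
      refine le_antisymm (fun w hw => mem_stdLattice.2 fun j => (hN j).1 w hw) (fun w hw => ?_)
      have hw' : ∀ j, Valued.v (w j) ≤ 1 := fun j => mem_stdLattice.1 hw j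
      rw [← Finset.univ_sum_single w]
      refine M.sum_mem fun i _ => ?_
      have hi : (Pi.single i (1 : K) : Fin 3 → K) ∈ M := (hax i 1).2 ((hroot i 1).1 (single_mem_stdLattice i))
      have hmem := M.smul_mem (⟨w i, hw' i⟩ : 𝒪[K]) hi
      have heq : ((⟨w i, hw' i⟩ : 𝒪[K]) • (Pi.single i (1 : K) : Fin 3 → K)) = Pi.single i (w i) := by
        change (w i : K) • (Pi.single i (1 : K) : Fin 3 → K) = Pi.single i (w i)
        rw [← Pi.single_smul, smul_eq_mul, mul_one]
      rwa [heq] at hmem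
    · rintro rfl
      refine ⟨⟨⟨1, by rw [Units.val_one, latt_one]⟩, mapGL_diagonal_stdLattice_eq hu T hT, fun i => ⟨fun w hw => mem_stdLattice.1 hw i,
        Pi.single i 1, single_mem_stdLattice i, by rw [Pi.single_eq_same, map_one]⟩⟩, ?_, hroot⟩
      refine ⟨fun _ => 1, fun _ => ⟨map_one σ, one_ne_zero⟩, ?_⟩
      have h1 : ∀ i : Fin 3, Valued.v ((fun _ : Fin 3 => (1 : K)) i) = 1 := fun _ => map_one _
      exact isSelfDualLattice_stdLattice (isIntMatrix_diagonal_of_v_le fun i => (h1 i).le) (isIntMatrix_diagonal_inv_of_v_eq_one h1)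
        (v_det_diagonal_eq_one h1) hϖ1
  -- the weight of the root is `1`: every fixed unit diagonal stabilises `𝒪³`
  have hweight : stabiliserWeight σ (stdLattice K 3) = 1 := by
    have hidx : (fixedUnitStabilizer σ (stdLattice K 3)).relIndex (fixedUnitTorus σ 3) = 1 := by
      rw [Subgroup.relIndex_eq_one]
      intro u hu'
      rw [fixedUnitStabilizer, Subgroup.mem_inf, mem_latticeStabilizer_iff]
      exact ⟨mapGL_diagonal_stdLattice_eq ((mem_fixedUnitTorus_iff σ u).1 hu').1 (diagGLUnits u) (coe_diagGLUnits u), hu'⟩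
    rw [stabiliserWeight, hidx, Nat.cast_one, inv_one]
  rw [hset, finsum_mem_singleton, hweight]

end Sockets

end Summit.HodgeConjecture.HodgeConjecture.Cruxes.H413.F0P3cDyRamDiagonalSplitCountSockets

end
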